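import Summits.ResolutionOfSingularities.ResolutionOfSingularities.Theorems.FrobeniusLadderFInjectiveMacaulayficationWildPinchCylinder
import Summits.ResolutionOfSingularities.ResolutionOfSingularities.Theorems.FrobeniusLadderFInjectiveMacaulayficationHypersurfaceLocalDim
import Mathlib.Algebra.DualNumber
import Mathlib.RingTheory.Ideal.KrullsHeightTheorem
import Mathlib.AlgebraicGeometry.AffineScheme
import HarnessLib

/-!
# The wild pinch cylinder is F-BAD along the pinch surface `B = V(u, t, y)`: Fedder at the height-2 prime `𝔮_B`
# (crux `FInjectiveMacaulayfication` stmt-ResolutionOfSingularities-15315, chain w45a; witness-2 data of res-L1-w45a-tri-2 KILL 2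
# `KILL-T3CLOSED.md`, res-L1-w45a-plan-1 R16.41 (2) / R16.42 (3); seat res-L1-w45a-stub-3 g6)

[OURS · L1 W4.5a] Support file (`--supports stmt-ResolutionOfSingularities-15315 --as helper`); NOT a statement of any manuscript;
theorem-only (no `def`, no named fact, unconditional); AI-written (AI review is weaker than expert review).

SETTING (`WildPinchCylinder`): `R = k[X₀,…,X₄]/(F)`, `F = X₂² + X₀²X₁X₂ + X₀X₁²` (`u = X₀, t = X₁, y = X₂, v₁ = X₃, v₂ = X₄`), `char k = 2`,
and the prime `𝔮_B = (ū, t̄, ȳ)` of the PINCH SURFACE `B = V(u,t,y) ≅ 𝔸²_{v₁v₂}` (the closure of the wild non-closed point `η_B`).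

* §1 `mem_span_X_of_kill_eq_zero`, `X2_mul_not_mem` — killing `X₀, X₁, X₂` and the dual-number valuation `X₂ ↦ ε`: for `S ∉ (X₀,X₁,X₂)`,
  `X₂·S ∉ (X₀, X₁, F)`; hence in `R`: `ȳ·s̄ ∉ (ū, t̄)` for `s̄ ∉ 𝔮_B` (`mk_X2_mul_not_mem`).
* §2 `height_B = 2`, `ringKrullDim_localization_B = 2` (chain `⊥ < 𝔮₀₂ < 𝔮_B`; Krull's height theorem for `(X₀,X₁,X₂)` upstairs and
  `HypersurfaceLocalDim.height_le_of_height_comap_le`).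
* §3 **`not_fCl_localization_B : ¬ FCl 2 (R_{𝔮_B})`** — FEDDER: `(ū, t̄)` is a system of parameters of the 2-dimensional `R_{𝔮_B}` (its radical
  contains `ȳ`, `ȳ² = (t̄ȳ)ū² + ū t̄²`), `ȳ² ∈ ((ū,t̄)R_{𝔮_B})^{[2]}` by the same identity, and `ȳ ∉ (ū,t̄)R_{𝔮_B}` (§1); so the parameter
  ideal `(ū,t̄)` is not Frobenius closed. §4 moves this to the scheme stalk of `Spec R` at the point `η_B` (`not_fCl_stalk_B`) and records
  that `η_B` is not closed and what its specialisations are.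
[cite: Fedder1983, Thm. 1.12] [cite: Matsumura1987, Thm. 13.5]
-/

-- single-problem summit: the doubled namespace component is forced
set_option linter.dupNamespace false

noncomputable section

open MvPolynomial IsLocalRing AlgebraicGeometry

namespace Summit.ResolutionOfSingularities.ResolutionOfSingularities.Theorems.FInjectiveMacaulayfication.WildPinchCylinderFedder

open Summit.ResolutionOfSingularities.ResolutionOfSingularities.Theorems.FInjectiveMacaulayfication
open Summit.ResolutionOfSingularities.ResolutionOfSingularities.Theorems.FInjectiveMacaulayfication.SliceableCentre (CMCl FCl FullCl)

variable (k : Type) [Field k]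

/-! ## §1 Killing `X₀, X₁, X₂`; the dual-number valuation -/

/-- If the substitution `X₀, X₁, X₂ ↦ 0` (other variables fixed) kills `S`, then `S ∈ (X₀, X₁, X₂)`. [folklore] -/
theorem mem_span_X_of_kill_eq_zero (S : MvPolynomial (Fin 5) k)
    (h : aeval (![0, 0, 0, X 3, X 4] : Fin 5 → MvPolynomial (Fin 5) k) S = 0) :
    S ∈ Ideal.span (MvPolynomial.X '' ({0, 1, 2} : Set (Fin 5)) : Set (MvPolynomial (Fin 5) k)) := by
  set I : Ideal (MvPolynomial (Fin 5) k) := Ideal.span (MvPolynomial.X '' ({0, 1, 2} : Set (Fin 5)) : Set (MvPolynomial (Fin 5) k))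
    with hI
  have key : (Ideal.Quotient.mkₐ k I).comp (aeval (![0, 0, 0, X 3, X 4] : Fin 5 → MvPolynomial (Fin 5) k)) =
      Ideal.Quotient.mkₐ k I := by
    refine MvPolynomial.algHom_ext fun i => ?_
    rw [AlgHom.comp_apply, aeval_X, Ideal.Quotient.mkₐ_eq_mk]
    fin_cases i
    · change Ideal.Quotient.mk I 0 = Ideal.Quotient.mk I (X 0)
      rw [map_zero, eq_comm, Ideal.Quotient.eq_zero_iff_mem]; exact Ideal.subset_span ⟨0, by simp, rfl⟩
    · change Ideal.Quotient.mk I 0 = Ideal.Quotient.mk I (X 1)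
      rw [map_zero, eq_comm, Ideal.Quotient.eq_zero_iff_mem]; exact Ideal.subset_span ⟨1, by simp, rfl⟩
    · change Ideal.Quotient.mk I 0 = Ideal.Quotient.mk I (X 2)
      rw [map_zero, eq_comm, Ideal.Quotient.eq_zero_iff_mem]; exact Ideal.subset_span ⟨2, by simp, rfl⟩
    · rfl
    · rfl
  have h1 := congrArg (fun φ : MvPolynomial (Fin 5) k →ₐ[k] MvPolynomial (Fin 5) k ⧸ I => φ S) key
  simp only [AlgHom.comp_apply, h, map_zero, Ideal.Quotient.mkₐ_eq_mk] at h1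
  exact Ideal.Quotient.eq_zero_iff_mem.mp h1.symm

/-- **`X₂·S ∉ (X₀, X₁) + (F)` for `S ∉ (X₀,X₁,X₂)`** — apply `ψ : X₀, X₁ ↦ 0, X₂ ↦ ε, X₃ ↦ X₃, X₄ ↦ X₄` into the dual numbers over
`k[X]`: `ψ F = ε² = 0`, `ψ (X₂ S) = ε·ψ S = inr (S(0,0,0,X₃,X₄)) ≠ 0`. [folklore; cf. `WildPinchCert.y_not_mem_span`] -/
theorem X2_mul_not_mem (F : MvPolynomial (Fin 5) k) (hF : F = X 2 ^ 2 + X 0 ^ 2 * X 1 * X 2 + X 0 * X 1 ^ 2)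
    (S : MvPolynomial (Fin 5) k) (hS : S ∉ Ideal.span (MvPolynomial.X '' ({0, 1, 2} : Set (Fin 5)) : Set (MvPolynomial (Fin 5) k))) :
    X 2 * S ∉ Ideal.span {(X 0 : MvPolynomial (Fin 5) k), X 1} ⊔ Ideal.span {F} := by
  -- the dual-number valuation
  let ψ : MvPolynomial (Fin 5) k →ₐ[k] DualNumber (MvPolynomial (Fin 5) k) :=
    aeval ![0, 0, DualNumber.eps, TrivSqZeroExt.inl (X 3), TrivSqZeroExt.inl (X 4)]
  have hψ0 : ψ (X 0) = 0 := by simp [ψ]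
  have hψ1 : ψ (X 1) = 0 := by simp [ψ]
  have hψ2 : ψ (X 2) = DualNumber.eps := by simp [ψ]
  have hψF : ψ F = 0 := by
    rw [hF, map_add, map_add, map_mul, map_mul, map_mul, map_pow, map_pow, map_pow, hψ0, hψ1, hψ2]
    simp [DualNumber.eps_mul_eps, pow_two]
  -- `fst ∘ ψ` is the killing substitution
  have hfst : (TrivSqZeroExt.fstHom k (MvPolynomial (Fin 5) k) (MvPolynomial (Fin 5) k)).comp ψ =
      aeval (![0, 0, 0, X 3, X 4] : Fin 5 → MvPolynomial (Fin 5) k) := by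
    refine MvPolynomial.algHom_ext fun i => ?_
    rw [AlgHom.comp_apply, aeval_X]
    fin_cases i <;> simp [TrivSqZeroExt.fstHom]
  intro hmem
  have hker : Ideal.span {(X 0 : MvPolynomial (Fin 5) k), X 1} ⊔ Ideal.span {F} ≤ RingHom.ker ψ.toRingHom := by
    refine sup_le ?_ ?_
    · rw [Ideal.span_le]
      rintro x (rfl | rfl)
      · exact hψ0
      · simpa using hψ1
    · rw [Ideal.span_le, Set.singleton_subset_iff]; exact hψF
  have h0 : ψ (X 2 * S) = 0 := hker hmem
  rw [map_mul, hψ2] at h0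
  -- `ε · ψ S = inr (fst (ψ S))`
  have hinr : DualNumber.eps * ψ S = TrivSqZeroExt.inr (TrivSqZeroExt.fst (ψ S)) := by
    refine TrivSqZeroExt.ext ?_ ?_
    · simp
    · simp [TrivSqZeroExt.snd_mul]
  rw [hinr] at h0
  have h0' : TrivSqZeroExt.fst (ψ S) = 0 := by
    have h := congrArg TrivSqZeroExt.snd h0
    rwa [TrivSqZeroExt.snd_inr, TrivSqZeroExt.snd_zero] at h
  -- so the killing substitution annihilates `S`, i.e. `S ∈ (X₀,X₁,X₂)`
  refine hS (mem_span_X_of_kill_eq_zero k S ?_)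
  rw [← hfst]
  exact h0'

section InR

variable (F : MvPolynomial (Fin 5) k) (hF : F = X 2 ^ 2 + X 0 ^ 2 * X 1 * X 2 + X 0 * X 1 ^ 2)

include hF in
/-- In `R = k[X]/(F)`: **`ȳ·s̄ ∉ (ū, t̄)` for `s̄ ∉ 𝔮_B = (ū,t̄,ȳ)`** (lift to `k[X]` and apply `X2_mul_not_mem`). [folklore] -/
theorem mk_X2_mul_not_mem (s : MvPolynomial (Fin 5) k ⧸ Ideal.span {F})
    (hs : s ∉ (Ideal.span (MvPolynomial.X '' ({0, 1, 2} : Set (Fin 5)) : Set (MvPolynomial (Fin 5) k))).map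
      (Ideal.Quotient.mk (Ideal.span {F}))) :
    Ideal.Quotient.mk (Ideal.span {F}) (X 2) * s ∉
      Ideal.span {Ideal.Quotient.mk (Ideal.span {F}) (X 0), Ideal.Quotient.mk (Ideal.span {F}) (X 1)} := by
  obtain ⟨S, rfl⟩ := Ideal.Quotient.mk_surjective s
  intro hmem
  have hS : S ∉ Ideal.span (MvPolynomial.X '' ({0, 1, 2} : Set (Fin 5)) : Set (MvPolynomial (Fin 5) k)) := fun h =>
    hs (Ideal.mem_map_of_mem _ h)
  refine X2_mul_not_mem k F hF S hS ?_
  have hspan : Ideal.span {Ideal.Quotient.mk (Ideal.span {F}) (X 0), Ideal.Quotient.mk (Ideal.span {F}) (X 1)} =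
      (Ideal.span {(X 0 : MvPolynomial (Fin 5) k), X 1}).map (Ideal.Quotient.mk (Ideal.span {F})) := by
    rw [Ideal.map_span, Set.image_insert_eq, Set.image_singleton]
  rw [← map_mul, hspan, ← Ideal.mem_comap, Ideal.comap_map_of_surjective _ Ideal.Quotient.mk_surjective,
    ← RingHom.ker_eq_comap_bot, Ideal.mk_ker] at hmem
  exact hmem

include hF in
/-- The Frobenius identity in `R` (characteristic `2`): **`ȳ² = (t̄ȳ)·ū² + ū·t̄²`**. [folklore] -/
theorem mk_X2_sq [CharP k 2] :
    Ideal.Quotient.mk (Ideal.span {F}) (X 2) ^ 2 =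
      (Ideal.Quotient.mk (Ideal.span {F}) (X 1) * Ideal.Quotient.mk (Ideal.span {F}) (X 2)) * Ideal.Quotient.mk (Ideal.span {F}) (X 0) ^ 2 +
        Ideal.Quotient.mk (Ideal.span {F}) (X 0) * Ideal.Quotient.mk (Ideal.span {F}) (X 1) ^ 2 := by
  have h2 : (2 : MvPolynomial (Fin 5) k) = 0 := by
    have h : (2 : k) = 0 := by exact_mod_cast CharP.cast_eq_zero k 2
    rw [← map_ofNat (C : k →+* MvPolynomial (Fin 5) k) 2, h, map_zero]
  have hF0 : Ideal.Quotient.mk (Ideal.span {F}) F = 0 := Ideal.Quotient.eq_zero_iff_mem.mpr (Ideal.mem_span_singleton_self F)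
  have key : (X 2 : MvPolynomial (Fin 5) k) ^ 2 = (X 1 * X 2) * X 0 ^ 2 + X 0 * X 1 ^ 2 + F - 2 * ((X 1 * X 2) * X 0 ^ 2 + X 0 * X 1 ^ 2) := by
    rw [hF]; ring
  rw [h2, zero_mul, sub_zero] at key
  have h := congrArg (Ideal.Quotient.mk (Ideal.span {F})) key
  simpa [hF0] using h

/-! ## §2 The height of `𝔮_B` and the dimension of `R_{𝔮_B}` -/

include hF in
/-- **`ht 𝔮_B = 2`**: `⊥ < 𝔮₀₂ < 𝔮_B` below, and `ht 𝔮_B ≤ ht (X₀,X₁,X₂) − 1 ≤ 3 − 1` (Krull's height theorem upstairs; heights drop modulo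
`F ≠ 0`). [cite: Matsumura1987, Thm. 13.5] -/
theorem height_B (Q : Ideal (MvPolynomial (Fin 5) k ⧸ Ideal.span {F})) [Q.IsPrime]
    (hQ : Q = (Ideal.span (MvPolynomial.X '' ({0, 1, 2} : Set (Fin 5)) : Set (MvPolynomial (Fin 5) k))).map
      (Ideal.Quotient.mk (Ideal.span {F}))) :
    Q.height = 2 := by
  classical
  haveI := WildPinchCylinder.isDomain_quotient k F hF
  have hF0 : F ≠ 0 := (WildPinchCylinder.prime_F k F hF).1.ne_zero
  apply le_antisymm
  · -- upper bound: `ht (X₀,X₁,X₂) ≤ 3` upstairs (Krull), heights drop modulo `F`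
    refine HypersurfaceLocalDim.height_le_of_height_comap_le hF0 Q 2 ?_
    rw [hQ, (WildPinchCylinder.isPrime_map_span_X k F hF (S := ({0, 1, 2} : Set (Fin 5))) (by simp) (by simp)).2]
    haveI hP : (Ideal.span (MvPolynomial.X '' ({0, 1, 2} : Set (Fin 5)) : Set (MvPolynomial (Fin 5) k))).IsPrime := by
      rw [← (WildPinchCylinder.isPrime_map_span_X k F hF (S := ({0, 1, 2} : Set (Fin 5))) (by simp) (by simp)).2, ← hQ]
      exact Ideal.comap_isPrime _ Q
    have hset : (MvPolynomial.X '' ({0, 1, 2} : Set (Fin 5)) : Set (MvPolynomial (Fin 5) k)) =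
        ↑({(X 0 : MvPolynomial (Fin 5) k), X 1, X 2} : Finset (MvPolynomial (Fin 5) k)) := by
      rw [Finset.coe_insert, Finset.coe_insert, Finset.coe_singleton, Set.image_insert_eq, Set.image_insert_eq, Set.image_singleton]
    have hmin : Ideal.span (MvPolynomial.X '' ({0, 1, 2} : Set (Fin 5)) : Set (MvPolynomial (Fin 5) k)) ∈
        (Ideal.span (↑({(X 0 : MvPolynomial (Fin 5) k), X 1, X 2} : Finset (MvPolynomial (Fin 5) k)) : Set (MvPolynomial (Fin 5) k))).minimalPrimes := by
      rw [← hset, Ideal.minimalPrimes_eq_subsingleton_self]; rfl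
    refine (Ideal.height_le_card_of_mem_minimalPrimes_span_finset hmin).trans ?_
    exact_mod_cast Finset.card_le_three
  · -- lower bound: the chain `⊥ < 𝔮₀₂ < 𝔮_B`
    haveI h02 : ((Ideal.span (MvPolynomial.X '' ({0, 2} : Set (Fin 5)) : Set (MvPolynomial (Fin 5) k))).map
        (Ideal.Quotient.mk (Ideal.span {F}))).IsPrime :=
      (WildPinchCylinder.isPrime_map_span_X k F hF (S := ({0, 2} : Set (Fin 5))) (by simp) (by simp)).1
    have hlt₁ : (⊥ : Ideal (MvPolynomial (Fin 5) k ⧸ Ideal.span {F})) <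
        (Ideal.span (MvPolynomial.X '' ({0, 2} : Set (Fin 5)) : Set (MvPolynomial (Fin 5) k))).map (Ideal.Quotient.mk (Ideal.span {F})) := by
      refine bot_lt_iff_ne_bot.mpr fun h => WildPinchCylinder.mk_X_ne_zero k F hF 0 ?_
      have hx : Ideal.Quotient.mk (Ideal.span {F}) (X 0) ∈
          (Ideal.span (MvPolynomial.X '' ({0, 2} : Set (Fin 5)) : Set (MvPolynomial (Fin 5) k))).map (Ideal.Quotient.mk (Ideal.span {F})) :=
        Ideal.mem_map_of_mem _ (Ideal.subset_span ⟨0, by simp, rfl⟩)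
      rw [h] at hx
      exact Ideal.mem_bot.mp hx
    have hlt₂ : (Ideal.span (MvPolynomial.X '' ({0, 2} : Set (Fin 5)) : Set (MvPolynomial (Fin 5) k))).map
        (Ideal.Quotient.mk (Ideal.span {F})) < Q := by
      rw [hQ]
      exact WildPinchCylinder.map_span_X_lt k F hF (S := ({0, 2} : Set (Fin 5))) (T := ({0, 1, 2} : Set (Fin 5))) (by simp) (by simp)
        (by intro i hi; simp only [Set.mem_insert_iff, Set.mem_singleton_iff] at hi ⊢; tauto) (j := 1) (by simp) (by simp)
    have h1 := Ideal.height_add_one_le_of_lt_of_isPrime hlt₁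
    have h2 := Ideal.height_add_one_le_of_lt_of_isPrime hlt₂
    rw [Ideal.height_bot, zero_add] at h1
    calc (2 : ℕ∞) = 1 + 1 := by norm_num
      _ ≤ ((Ideal.span (MvPolynomial.X '' ({0, 2} : Set (Fin 5)) : Set (MvPolynomial (Fin 5) k))).map
            (Ideal.Quotient.mk (Ideal.span {F}))).height + 1 := add_le_add h1 le_rfl
      _ ≤ Q.height := h2

include hF in
/-- **`dim R_{𝔮_B} = 2`.** [cite: Matsumura1987, Thm. 13.5] -/
theorem ringKrullDim_localization_B (Q : Ideal (MvPolynomial (Fin 5) k ⧸ Ideal.span {F})) [Q.IsPrime]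
    (hQ : Q = (Ideal.span (MvPolynomial.X '' ({0, 1, 2} : Set (Fin 5)) : Set (MvPolynomial (Fin 5) k))).map
      (Ideal.Quotient.mk (Ideal.span {F}))) :
    ringKrullDim (Localization.AtPrime Q) = 2 := by
  rw [IsLocalization.AtPrime.ringKrullDim_eq_height Q (Localization.AtPrime Q), height_B k F hF Q hQ]
  rfl

end InR

/-! ## §3 Fedder at `𝔮_B`: the parameter ideal `(ū, t̄) R_{𝔮_B}` is not Frobenius closed -/

section Fedder

variable (F : MvPolynomial (Fin 5) k) (hF : F = X 2 ^ 2 + X 0 ^ 2 * X 1 * X 2 + X 0 * X 1 ^ 2)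

include hF in
/-- **`R_{𝔮_B}` FAILS THE F-CLAUSE** (`p = 2`): `dim R_{𝔮_B} = 2`, `(ū, t̄)` has maximal radical (`ȳ² = (t̄ȳ)ū² + ū t̄²`), `ȳ² ∈ ((ū,t̄))^{[2]}`
and `ȳ ∉ (ū, t̄) R_{𝔮_B}`. This is Fedder's criterion read at the generic point of the pinch surface: `F ∈ (X₀,X₁,X₂)^{[2]}`.
[cite: Fedder1983, Thm. 1.12] -/
theorem not_fCl_localization_B [CharP k 2] (Q : Ideal (MvPolynomial (Fin 5) k ⧸ Ideal.span {F})) [Q.IsPrime]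
    (hQ : Q = (Ideal.span (MvPolynomial.X '' ({0, 1, 2} : Set (Fin 5)) : Set (MvPolynomial (Fin 5) k))).map
      (Ideal.Quotient.mk (Ideal.span {F}))) :
    ¬ FCl 2 (Localization.AtPrime Q) := by
  haveI := WildPinchCylinder.isDomain_quotient k F hF
  intro hFCl
  -- names
  let a := algebraMap (MvPolynomial (Fin 5) k ⧸ Ideal.span {F}) (Localization.AtPrime Q)
  let u : Localization.AtPrime Q := a (Ideal.Quotient.mk (Ideal.span {F}) (X 0))
  let t : Localization.AtPrime Q := a (Ideal.Quotient.mk (Ideal.span {F}) (X 1))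
  let y : Localization.AtPrime Q := a (Ideal.Quotient.mk (Ideal.span {F}) (X 2))
  let s : Fin 2 → Localization.AtPrime Q := ![u, t]
  have hu : u ∈ Ideal.span (Set.range s) := Ideal.subset_span ⟨0, rfl⟩
  have ht : t ∈ Ideal.span (Set.range s) := Ideal.subset_span ⟨1, rfl⟩
  have hmemQ : ∀ i : Fin 5, i ∈ ({0, 1, 2} : Set (Fin 5)) → Ideal.Quotient.mk (Ideal.span {F}) (X i) ∈ Q := fun i hi => by
    rw [hQ]; exact Ideal.mem_map_of_mem _ (Ideal.subset_span ⟨i, hi, rfl⟩)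
  -- the Frobenius identity `y² = (t y) u² + u t²`
  have hysq : y ^ 2 = (t * y) * u ^ 2 + u * t ^ 2 := by
    have h := congrArg a (mk_X2_sq k F hF)
    simpa only [map_pow, map_mul, map_add] using h
  -- (1) `dim = 2`
  have hd := ringKrullDim_localization_B k F hF Q hQ
  -- (2) the radical of `(u, t)` is the maximal ideal
  have hle : Ideal.span (Set.range s) ≤ maximalIdeal (Localization.AtPrime Q) := by
    rw [Ideal.span_le, Set.range_subset_iff]
    intro i
    fin_cases i
    · exact (IsLocalization.AtPrime.to_map_mem_maximal_iff (Localization.AtPrime Q) Q _).mpr (hmemQ 0 (by simp))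
    · exact (IsLocalization.AtPrime.to_map_mem_maximal_iff (Localization.AtPrime Q) Q _).mpr (hmemQ 1 (by simp))
  have hrad : (Ideal.span (Set.range s)).radical = maximalIdeal (Localization.AtPrime Q) := by
    apply le_antisymm
    · rw [← (maximalIdeal.isMaximal (Localization.AtPrime Q)).isPrime.radical]
      exact Ideal.radical_mono hle
    · rw [← Localization.AtPrime.map_eq_maximalIdeal, Ideal.map_le_iff_le_comap]
      intro x hx
      rw [hQ] at hx
      have hsub : Ideal.span (MvPolynomial.X '' ({0, 1, 2} : Set (Fin 5)) : Set (MvPolynomial (Fin 5) k)) ≤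
          ((Ideal.span (Set.range s)).radical.comap a).comap (Ideal.Quotient.mk (Ideal.span {F})) := by
        rw [Ideal.span_le]
        rintro _ ⟨i, hi, rfl⟩
        simp only [Set.mem_insert_iff, Set.mem_singleton_iff] at hi
        rw [SetLike.mem_coe, Ideal.mem_comap, Ideal.mem_comap]
        rcases hi with rfl | rfl | rfl
        · exact Ideal.le_radical hu
        · exact Ideal.le_radical ht
        · refine ⟨2, ?_⟩
          change y ^ 2 ∈ Ideal.span (Set.range s)
          rw [hysq]
          exact Ideal.add_mem _ (Ideal.mul_mem_left _ _ (Ideal.pow_mem_of_mem _ hu 2 two_pos))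
            (Ideal.mul_mem_left _ _ (Ideal.pow_mem_of_mem _ ht 2 two_pos))
      have hx' := Ideal.map_mono (f := Ideal.Quotient.mk (Ideal.span {F})) hsub hx
      rw [Ideal.map_comap_of_surjective _ Ideal.Quotient.mk_surjective] at hx'
      exact hx'
  have hmax : (Ideal.span (Set.range s)).radical.IsMaximal := by rw [hrad]; exact maximalIdeal.isMaximal _
  -- (3) `y² ∈ (u,t)^{[2]}`
  have hfrob : ∃ e : ℕ, y ^ 2 ^ e ∈ Ideal.span ((fun z : Localization.AtPrime Q => z ^ 2 ^ e) ''
      (Ideal.span (Set.range s) : Set (Localization.AtPrime Q))) := by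
    refine ⟨1, ?_⟩
    rw [pow_one, hysq]
    refine Ideal.add_mem _ (Ideal.mul_mem_left _ _ (Ideal.subset_span ⟨u, hu, rfl⟩)) (Ideal.mul_mem_left _ _ (Ideal.subset_span ⟨t, ht, rfl⟩))
  -- (4) so the F-clause would give `y ∈ (u, t)`, i.e. `ȳ s̄ ∈ (ū, t̄)` for some `s̄ ∉ 𝔮_B`
  have hy : y ∈ Ideal.span (Set.range s) := hFCl 2 hd s hmax y hfrob
  have hle' : Ideal.span (Set.range s) ≤ (Ideal.span {Ideal.Quotient.mk (Ideal.span {F}) (X 0), Ideal.Quotient.mk (Ideal.span {F}) (X 1)}).map a := by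
    rw [Ideal.span_le, Set.range_subset_iff]
    intro i
    fin_cases i
    · exact Ideal.mem_map_of_mem _ (Ideal.subset_span (by simp))
    · exact Ideal.mem_map_of_mem _ (Ideal.subset_span (by simp))
  obtain ⟨⟨⟨i, hi⟩, ⟨r, hr⟩⟩, hy'⟩ := (IsLocalization.mem_map_algebraMap_iff Q.primeCompl (Localization.AtPrime Q)).mp (hle' hy)
  simp only at hy'
  have hinj : Function.Injective a := IsLocalization.injective (Localization.AtPrime Q) Q.primeCompl_le_nonZeroDivisors
  have heq : Ideal.Quotient.mk (Ideal.span {F}) (X 2) * r = i := hinj (by rw [map_mul]; exact hy')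
  exact mk_X2_mul_not_mem k F hF r (by rw [← hQ]; exact hr) (heq ▸ hi)

end Fedder

/-! ## §4 At the point `η_B` of `Spec R` -/

section Stalk

variable (F : MvPolynomial (Fin 5) k) (hF : F = X 2 ^ 2 + X 0 ^ 2 * X 1 * X 2 + X 0 * X 1 ^ 2)

include hF in
/-- **The scheme stalk `𝒪_{Spec R, η_B}` fails the F-clause** (`not_fCl_localization_B` along `Spec.stalkIso`). [cite: Fedder1983, Thm. 1.12] -/
theorem not_fCl_stalk_B [CharP k 2] (η : Spec (.of (MvPolynomial (Fin 5) k ⧸ Ideal.span {F})))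
    (hη : η.asIdeal = (Ideal.span (MvPolynomial.X '' ({0, 1, 2} : Set (Fin 5)) : Set (MvPolynomial (Fin 5) k))).map
      (Ideal.Quotient.mk (Ideal.span {F}))) :
    ¬ FCl 2 ((Spec (.of (MvPolynomial (Fin 5) k ⧸ Ideal.span {F}))).presheaf.stalk η) := fun h =>
  not_fCl_localization_B k F hF η.asIdeal hη
    (FiLocusOpenOfAffine.fClause_of_ringEquiv 2 (A := (Spec (.of (MvPolynomial (Fin 5) k ⧸ Ideal.span {F}))).presheaf.stalk η)
      (B := Localization.AtPrime η.asIdeal) (Spec.stalkIso (.of (MvPolynomial (Fin 5) k ⧸ Ideal.span {F})) η).commRingCatIsoToRingEquiv h)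

include hF in
/-- **Any ring isomorphic to `𝒪_{Spec R, η_B}` fails the merged CM ∧ F clause** (the second conjunct of `FullCl`) — the form consumed at
the generic point `η′` of the strict transform of `B` on a blow-up that is an isomorphism near `η_B`. [cite: Fedder1983, Thm. 1.12] -/
theorem not_clause_of_ringEquiv_stalk_B [CharP k 2] (η : Spec (.of (MvPolynomial (Fin 5) k ⧸ Ideal.span {F})))
    (hη : η.asIdeal = (Ideal.span (MvPolynomial.X '' ({0, 1, 2} : Set (Fin 5)) : Set (MvPolynomial (Fin 5) k))).map
      (Ideal.Quotient.mk (Ideal.span {F}))) {O : Type} [CommRing O]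
    (e : O ≃+* (Spec (.of (MvPolynomial (Fin 5) k ⧸ Ideal.span {F}))).presheaf.stalk η) :
    ¬ (∀ d : ℕ, ringKrullDim O = d → ∀ s : Fin d → O, (Ideal.span (Set.range s)).radical.IsMaximal →
        RingTheory.Sequence.IsWeaklyRegular O (List.ofFn s) ∧
        ∀ z : O, (∃ e : ℕ, z ^ 2 ^ e ∈ Ideal.span ((fun w : O => w ^ 2 ^ e) '' (Ideal.span (Set.range s) : Set O))) →
          z ∈ Ideal.span (Set.range s)) := fun h =>
  not_fCl_stalk_B k F hF η hη (FiLocusOpenOfAffine.fClause_of_ringEquiv 2 e fun d hd s hs => (h d hd s hs).2)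

end Stalk

end Summit.ResolutionOfSingularities.ResolutionOfSingularities.Theorems.FInjectiveMacaulayfication.WildPinchCylinderFedder

end
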